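import Summits.BirchSwinnertonDyer.BirchSwinnertonDyer.Theorems.UniversalToricDescentDefectTransportTwinBaseFiniteOnly
import Summits.BirchSwinnertonDyer.BirchSwinnertonDyer.Theorems.SchneiderFreeAdditiveX3AnticycControlAdditiveBaseCountFiniteAnyTorsion
import HarnessLib

/-!
# Stub B′ of ♭T′ for a twin of `K`-RANK ONE with finite Ш (route `UniversalToricDescent`, crux ♭T′
# stmt-BirchSwinnertonDyer-26975 `DefectTransportModThreePT`, line `sigmacongruence`; seat `bsd-wall-utd-p1` gen 13)

`…DefectTransportTwinBaseFiniteOnly` closes stub B′ (`stub_lambdaTransportPT`: the (iv)-free λ-transport for `X_{∅,0}`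
along `E[3] ≅ E′[3]`) modulo ONE residue (R1): the twin's base finiteness `Sel_v(K, E′[3^∞]) < ∞` at `v ∣ 3`.  This file
reads (R1) off the standard arithmetic of the twin over the Heegner field — `rank E′(K) = 1` and `Ш(E′/K)` finite, i.e. the
output of Gross–Zagier–Kolyvagin at `r_an(E′/K) = 1` — by the tree theorem `finite_selmerAcBase_of_rankOne_anyTorsion`
(JSW17 Prop. 3.2.1 / Castella 2018 (3.2.1), torsion allowed; Poitou–Tate sum formula from B′'s own `hPT`).  So the
PLANNER DATUM of the memo is now a Lean implication: a twin supply delivering `rank E′(K) = 1 ∧ #Ш(E′/K) < ∞` at the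
kernel's `K` closes the algebraic half of ♭T′ BY NAME (`defectTransport_algebraicHalf_lambda_of_wall_of_twinRankOne`).

THEOREM ONLY; no definition, no named fact, no `sorry`; conditional on the cited Poitou–Tate facts (binders of ♭T′).  BSD
is not advanced by this file.  References: [GreenbergVatsal2000] Thm. (1.4), §2; [JetchevSkinnerWan2017] Prop. 3.2.1;
[Castella2018] Thm. 2.3; [MilneADT2006] I.4.10.
-/

set_option autoImplicit false
-- `…BirchSwinnertonDyer.BirchSwinnertonDyer.Theorems…` is the problem's mandated namespace (D-0017).
set_option linter.dupNamespace false

noncomputable section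

open scoped Classical

namespace Summit.BirchSwinnertonDyer.BirchSwinnertonDyer.Theorems.UniversalToricDescentDefectTransport

open Function Field NumberField IsDedekindDomain WeierstrassCurve
open Literature.NumberTheory.GaloisRepresentations Literature.NumberTheory.EllipticCurves
  Literature.NumberTheory.EllipticCurves.GreenbergSelmer Literature.NumberTheory.GaloisCohomology
  Literature.NumberTheory.EllipticCurves.IwasawaAlgebra Literature.NumberTheory.EllipticCurves.Rank1Residual
  Summit.BirchSwinnertonDyer.Rank1Residual Summit.BirchSwinnertonDyer.Rank1Residual.X11b
  Summit.BirchSwinnertonDyer.Rank1Residual.X11b.AcSelmer Summit.BirchSwinnertonDyer.Rank1Residual.Iwasawa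
  Summit.BirchSwinnertonDyer.Rank1Residual.X11b.Coinv Summit.BirchSwinnertonDyer.Rank1Residual.X11b.LocBridge
  Summit.BirchSwinnertonDyer.BirchSwinnertonDyer.Theorems.UniversalToricDescentSigmaPassage
  Summit.BirchSwinnertonDyer.BirchSwinnertonDyer.Theorems.UniversalToricDescentSigmaLocalImage
  Summit.BirchSwinnertonDyer.BirchSwinnertonDyer.Theorems.UniversalToricDescentSigmaCoinvariants
  Summit.Ventures.HodgeRepro2.T5DegreeOneNumberField
  Summit.BirchSwinnertonDyer.BirchSwinnertonDyer.Theorems.SchneiderFreeControlAtoms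
  Summit.BirchSwinnertonDyer.BirchSwinnertonDyer.Theorems.SchneiderFreeAdditiveX3

/-- **Stub B′ for a twin of `K`-rank one with finite Ш.**  Conclusion = B′'s conclusion VERBATIM; hypotheses = B′'s binders
+ `rank E′(K) = 1` + `Ш(E′/K)` finite.  (R1) `Sel_v(K, E′[3^∞]) < ∞` at `v ∣ 3` is `finite_selmerAcBase_of_rankOne_anyTorsion`
(Poitou–Tate sum formula from `hPT` by `poitouTate_sum_localTatePairing_eq_zero_of_selmerStructure_duality`); then
`defectTransport_algebraicHalf_lambda_of_wall_of_twinBaseFinite_of_not_addv`.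
[cite: GreenbergVatsal2000, Thm. (1.4), §2 Prop. (2.1), (2.8)] [cite: JetchevSkinnerWan2017, Prop. 3.2.1 (proof, arXiv:1512.06894 pp. 10–11)] -/
theorem defectTransport_algebraicHalf_lambda_of_wall_of_twinRankOne (W W' : WeierstrassCurve ℚ)
    [W.IsElliptic] [W.IsGloballyMinimal] [W'.IsElliptic] [W'.IsGloballyMinimal] {N N' : ℕ} (K : Type) [Field K]
    [NumberField K]
    (hO6 : Additive.ClassO6 W 3) (hsurj : W.HasSurjectiveModNGaloisRep 3) (hN : W.conductorNorm ℤ = N)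
    (hcong : O6.ModPCongruent W' W 3) (hadd' : ¬ Addv W' 3) (hN' : W'.conductorNorm ℤ = N')
    (hK : IsImaginaryQuadratic K)
    (hHe : SatisfiesHeegnerHypothesis N K) (hHe' : SatisfiesHeegnerHypothesis N' K)
    (κ : ZpExtension K 3) (hκ : κ.IsAnticyclotomic) (γ : absoluteGaloisGroup K)
    [Fact (κ.IsTopGenerator γ)] {𝔭' : HeightOneSpectrum (𝓞 K)} (h𝔭' : ((3 : ℕ) : 𝓞 K) ∈ 𝔭'.asIdeal)
    (hT : Module.IsTorsion (IwasawaAlgebra 3) (XAc (W.baseChange K) 3 κ 𝔭' ∅ γ))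
    {L : UnrSeries 3}
    (hle : Ideal.span {L} ≤
      (XAc.charIdeal (W.baseChange K) 3 κ 𝔭' ∅ γ).map (PowerSeries.map (Halves.toUnr 3)))
    (hi : ∃ i : ℕ, ‖((PowerSeries.coeff i L : unrIntegers 3) : ℂ_[3])‖ = 1)
    (hPT : poitouTate_selmerStructure_duality K) (hPT2 : poitouTate_sha_tateDual K)
    (hfin : ∀ v : HeightOneSpectrum (𝓞 K), ((3 : ℕ) : 𝓞 K) ∈ v.asIdeal →
      Finite (selmerAcBase (W.baseChange K) 3 v ∅))
    (hrank' : (W'.baseChange K).mordellWeilRank = 1) (hSha' : (W'.baseChange K).ShaFinite) :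
    ∃ (T : Finset (HeightOneSpectrum (𝓞 K))) (c s s' : HeightOneSpectrum (𝓞 K) → ℕ),
      (↑T = {v : HeightOneSpectrum (𝓞 K) | ((3 : ℕ) : 𝓞 K) ∉ v.asIdeal ∧
        (¬ (W.baseChange K).HasGoodReductionAt v ∨ ¬ (W'.baseChange K).HasGoodReductionAt v)}) ∧
      (∀ v ∈ T, (∃ d₀ : decomp (K := K) v, (κ (d₀ : absoluteGaloisGroup K)).toAdd = (3 : ℤ_[3]) ^ c v) ∧
        (∀ d : decomp (K := K) v, (3 : ℤ_[3]) ^ c v ∣ (κ (d : absoluteGaloisGroup K)).toAdd) ∧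
        Nat.card {f : subgroupH1 (kerD κ v) ((W.baseChange K).geomPrimaryTorsion 3) // 3 • f = 0} =
          3 ^ s v ∧
        Nat.card {f : subgroupH1 (kerD κ v) ((W'.baseChange K).geomPrimaryTorsion 3) // 3 • f = 0} =
          3 ^ s' v) ∧
      (∃ g : UnrSeries 3,
        (XAc.charIdeal (W.baseChange K) 3 κ 𝔭' ∅ γ).map (PowerSeries.map (Halves.toUnr 3)) =
            Ideal.span {g} ∧
          (∀ i < lambdaInvariant 3 (XAc (W.baseChange K) 3 κ 𝔭' ∅ γ),
            ‖((PowerSeries.coeff i g : unrIntegers 3) : ℂ_[3])‖ < 1) ∧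
          ‖((PowerSeries.coeff (lambdaInvariant 3 (XAc (W.baseChange K) 3 κ 𝔭' ∅ γ)) g :
            unrIntegers 3) : ℂ_[3])‖ = 1) ∧
      Module.IsTorsion (IwasawaAlgebra 3) (XAc (W'.baseChange K) 3 κ 𝔭' ∅ γ) ∧
      (∃ g' : UnrSeries 3,
        (XAc.charIdeal (W'.baseChange K) 3 κ 𝔭' ∅ γ).map (PowerSeries.map (Halves.toUnr 3)) =
            Ideal.span {g'} ∧
          (∀ i < lambdaInvariant 3 (XAc (W'.baseChange K) 3 κ 𝔭' ∅ γ),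
            ‖((PowerSeries.coeff i g' : unrIntegers 3) : ℂ_[3])‖ < 1) ∧
          ‖((PowerSeries.coeff (lambdaInvariant 3 (XAc (W'.baseChange K) 3 κ 𝔭' ∅ γ)) g' :
            unrIntegers 3) : ℂ_[3])‖ = 1) ∧
      lambdaInvariant 3 (XAc (W.baseChange K) 3 κ 𝔭' ∅ γ) + ∑ v ∈ T, 3 ^ c v * s v =
        lambdaInvariant 3 (XAc (W'.baseChange K) 3 κ 𝔭' ∅ γ) + ∑ v ∈ T, 3 ^ c v * s' v := by
  -- `3` splits in the Heegner field (`3 ∣ N`: the wild curve is additive at `3`)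
  have hadd : Addv W 3 := hO6.2.1
  have hpN : 3 ∣ W.conductorNorm ℤ := (W.dvd_conductorNorm_iff_not_hasGoodReductionAtPrime 3).mpr hadd.1
  have hsplit : SplitsIn K 3 := hHe 3 (Fact.out) (hN ▸ hpN)
  -- (R1) from rank one + finite Ш
  have hfin' : ∀ v : HeightOneSpectrum (𝓞 K), ((3 : ℕ) : 𝓞 K) ∈ v.asIdeal →
      Finite (selmerAcBase (W'.baseChange K) 3 v ∅) := fun v hv ↦ by
    obtain ⟨hev, hfv⟩ := degreeOne_of_splitsIn hK.1 hsplit hv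
    exact finite_selmerAcBase_of_rankOne_anyTorsion W' 3 K
      (poitouTate_sum_localTatePairing_eq_zero_of_selmerStructure_duality hPT) hK hsplit hrank' hSha' v hv hev hfv
  exact defectTransport_algebraicHalf_lambda_of_wall_of_twinBaseFinite_of_not_addv W W' K hO6 hsurj hN hcong hadd' hN'
    hK hHe hHe' κ hκ γ h𝔭' hT hle hi hPT hPT2 hfin hfin'

end Summit.BirchSwinnertonDyer.BirchSwinnertonDyer.Theorems.UniversalToricDescentDefectTransport

end
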